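import Literature.NumberTheory.Automorphic.ResGLnCuspidalEigenclassOfClean
import Literature.NumberTheory.Automorphic.ResGLnCuspidalEigenclassOfConeFamily
import Literature.NumberTheory.Automorphic.ResGLnHermitianConeOpen
import HarnessLib

/-!
# Crux `HeckeEigenvalueField` (stmt-Langlands-13632), line `Sketch` — the cone eigenfamily only needs
# CLEAN cuspidal data (the Gelfand–Piatetski-Shapiro step inside the skeleton, lead c8)

Namespace `Summit.Langlands.Langlands.Theorems.HeckeEigenvalueField.Res` (the line's namespace).
Theorems only; a `--supports` helper for the registered stub `stub_coneEigenfamily_rank_two` of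
`Lines/Sketch.lean` (v9, c7): it is implied by its restriction to CLEAN cuspidal data
`π₀ = C / ⊥` (`W' = ⊥`) on which the central `1 ∈ 𝔤 = 𝔤𝔩_n(K_∞)` acts by a scalar and on whose
`K(𝔫)`-invariants the unramified double-coset operators `T_{v,i}(ϖ_v)`, `v ∤ 𝔫`, act by scalars ON
THE NOSE (not modulo `W'`) — the setting in which the Borel–Wallach dictionary (closed `E_λ`-valued
forms built from `(𝔤, K_∞)`-cocycles with values in cusp FUNCTIONS) makes sense.

* `coneEigenfamily_rank_two_of_clean` — the reduction: realise an arbitrary cuspidal `π = W / W'`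
  by a clean `π₀` (`CuspidalAutomorphicRepData.exists_isShiftRealisation_of_sSup_irreducible` over
  the PROVED semisimplicity `AutomorphicRepsGL.stable_cuspidal_eq_sSup_irreducible_holds`), move the
  infinity type (`IsShiftRealisation.hasInfinityType`), the scalar action of `1 ∈ 𝔤`
  (`IsShiftRealisation.lieDeriv_one_eq_smul`) and the `K(𝔫)`-fixed vector
  (`IsShiftRealisation.exists_fixed_ne_zero`) to `π₀`, read off the exact `T_{v,i}`-scalars `c₀` on
  `π₀.W^{K(𝔫)}` (Flath, `Flath1979_heckeOperator_ofLocal_sub_smul_mem_holds`, exact because `W₀' = ⊥`),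
  take the cone eigenfamily of `π₀` for `c₀`, and identify `c₀ v i = c v i` at `v ∤ 𝔫`: both are the
  Satake–Tamagawa value of THE Satake parameter of `π` at `v` (`hasSatakeParamAt_of_fixed`,
  `IsShiftRealisation.hasSatakeParamAt`, `hasSatakeParamAt_unique_holds`,
  `HasSatakeParamAt.eq_esymm_of_sub_smul_mem`).

[cite: BorelJacquetCorvallis1979, §4.6 and 5.7] [cite: FlathCorvallis1979, Thm. 3]
[cite: Clozel1990, §3.5 (p. 123)]
-/

noncomputable section

open scoped Classical
open NumberField IsDedekindDomain
open Literature.NumberTheory.Automorphic Literature.NumberTheory.DiophantineGeometry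
  Literature.Barriers.Langlands

set_option linter.dupNamespace false -- project-wide: `Summit.Langlands.Langlands` is the mandated namespace

namespace Summit.Langlands.Langlands.Theorems.HeckeEigenvalueField.Res

open ResGLnCohomology BigHeckeGLn

set_option maxHeartbeats 1000000 in
/-- **The cone eigenfamily for arbitrary cuspidal data from the clean case** (the text of the
registered stub `stub_coneEigenfamily_rank_two` of line `Sketch`, from its CLEAN case `hC`):
realise `π = W / W'` by a clean `π₀ = C / ⊥` (Gelfand–Piatetski-Shapiro, in tree), move the
infinity type, the scalar action of `1 ∈ 𝔤` and the `K(𝔫)`-fixed vector to `π₀`, take the exact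
`T_{v,i}(ϖ_v)`-scalars `c₀` on `C^{K(𝔫)}` (Flath, exact since `W₀' = ⊥`), apply the clean statement,
and identify `c₀ v i = c v i` for `v ∤ 𝔫`, `i ≤ n` through THE Satake parameter of `π` at `v`.
[cite: BorelJacquetCorvallis1979, §4.6 and 5.7] [cite: FlathCorvallis1979, Thm. 3]
[cite: Clozel1990, §3.5 (p. 123)] -/
theorem coneEigenfamily_rank_two_of_clean :
    (∀ (n : ℕ) (K : Type) [Field K] [NumberField K] (hcpt : isCompact_glFiniteIntegralLevel n K)
        (𝔫 : Ideal (𝓞 K)) (lam : (K →+* ℂ) → Fin n → ℤ), 2 ≤ n → 𝔫 ≠ 0 →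
        (∀ τ, Weight.IsDominant (lam τ)) →
        ∀ π : CuspidalAutomorphicRepData n K hcpt, π.1.W' = ⊥ →
          (∃ μ : ℂ, ∀ c ∈ π.1.W, lieDeriv (AutomorphyDatum.gl n K hcpt).ofArch
            (⟨1, trivial⟩ : (AutomorphyDatum.gl n K hcpt).arch.lie) c = μ • c) →
          (∃ T : InfinityType K n, π.1.HasInfinityType T ∧
            ∀ τ : K →+* ℂ, (T τ).map ArchWeight.a =
              (cohomologicalInfinityType n K (Weight.dual (lam τ)) τ).map ArchWeight.a) →
          (∃ φ ∈ π.1.W, φ ≠ 0 ∧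
            ∀ u ∈ principalCongruenceLevel n K 𝔫, rightTranslation (AdelicGroupData.gl n K) u φ = φ) →
          ∀ c : HeightOneSpectrum (𝓞 K) → ℕ → ℂ,
            (∀ v : HeightOneSpectrum (𝓞 K), ¬ v.asIdeal ∣ 𝔫 → ∀ i ≤ n, ∀ ψ ∈ π.1.W,
              (∀ u ∈ principalCongruenceLevel n K 𝔫, rightTranslation (AdelicGroupData.gl n K) u ψ = ψ) →
              heckeOperator (rightTranslation (AdelicGroupData.gl n K))
                  (principalCongruenceLevel n K 𝔫)
                  (heckeDiagAt n K v (uniformizerAt v) i) ψ = c v i • ψ) →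
            ∃ (q : ℕ) (ω : FiniteAdelicGL n K → ResGLnCone.hermSpace n K →
                (ResGLnCone.hermSpace n K) [⋀^Fin q]→L[ℝ] CoeffModule ℂ n K lam)
              (hω : TwistedQuotient.IsConeFormFamily (diagPos n K) (level n K 𝔫)
                (coeffRepPos ℂ n K lam)
                ((ResGLnCone.coneActionRat n K).comp (glTotPos n K).subtype)
                (ResGLnCone.posCone n K) ω),
              TwistedQuotient.coneClass hω (ResGLnCone.hermOne_mem_posCone n K) ≠ 0 ∧
              ∀ v : HeightOneSpectrum (𝓞 K), ¬ v.asIdeal ∣ 𝔫 → ∀ i ≤ n,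
                ∀ (cL : FiniteAdelicGL n K ⧸ level n K 𝔫), ∀ y ∈ ResGLnCone.posCone n K,
                  ∀ vec : Fin q → ResGLnCone.hermSpace n K,
                    ArithmeticQuotient.heckeFun ℂ (level n K 𝔫) (heckeElement n K v i)
                      (CoeffModule ℂ n K lam) (fun c' => ω c'.out y vec) cL = c v i • ω cL.out y vec) →
    ∀ (n : ℕ) (K : Type) [Field K] [NumberField K] (hcpt : isCompact_glFiniteIntegralLevel n K)
      (𝔫 : Ideal (𝓞 K)) (lam : (K →+* ℂ) → Fin n → ℤ), 2 ≤ n → 𝔫 ≠ 0 →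
      (∀ τ, Weight.IsDominant (lam τ)) →
      ∀ π : CuspidalAutomorphicRepData n K hcpt,
        (∃ T : InfinityType K n, π.1.HasInfinityType T ∧
          ∀ τ : K →+* ℂ, (T τ).map ArchWeight.a =
            (cohomologicalInfinityType n K (Weight.dual (lam τ)) τ).map ArchWeight.a) →
        ∀ φ ∈ π.1.W, φ ∉ π.1.W' →
          (∀ u ∈ principalCongruenceLevel n K 𝔫,
            rightTranslation (AdelicGroupData.gl n K) u φ = φ) →
          ∀ c : HeightOneSpectrum (𝓞 K) → ℕ → ℂ,
            (∀ v : HeightOneSpectrum (𝓞 K), ¬ v.asIdeal ∣ 𝔫 → ∀ i ≤ n,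
              heckeOperator (rightTranslation (AdelicGroupData.gl n K))
                  (principalCongruenceLevel n K 𝔫)
                  (heckeDiagAt n K v (uniformizerAt v) i) φ - c v i • φ ∈ π.1.W') →
            ∃ (q : ℕ) (ω : FiniteAdelicGL n K → ResGLnCone.hermSpace n K →
                (ResGLnCone.hermSpace n K) [⋀^Fin q]→L[ℝ] CoeffModule ℂ n K lam)
              (hω : TwistedQuotient.IsConeFormFamily (diagPos n K) (level n K 𝔫)
                (coeffRepPos ℂ n K lam)
                ((ResGLnCone.coneActionRat n K).comp (glTotPos n K).subtype)
                (ResGLnCone.posCone n K) ω),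
              TwistedQuotient.coneClass hω (ResGLnCone.hermOne_mem_posCone n K) ≠ 0 ∧
              ∀ v : HeightOneSpectrum (𝓞 K), ¬ v.asIdeal ∣ 𝔫 → ∀ i ≤ n,
                ∀ (cL : FiniteAdelicGL n K ⧸ level n K 𝔫), ∀ y ∈ ResGLnCone.posCone n K,
                  ∀ vec : Fin q → ResGLnCone.hermSpace n K,
                    ArithmeticQuotient.heckeFun ℂ (level n K 𝔫) (heckeElement n K v i)
                      (CoeffModule ℂ n K lam) (fun c' => ω c'.out y vec) cL = c v i • ω cL.out y vec := by
  intro hC n K _ _ hcpt 𝔫 lam hn h𝔫 hlam π hT φ hφW hφW' hfix c hc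
  haveI : NeZero n := ⟨by omega⟩
  -- (1) a clean realisation `π₀ = C / ⊥` of `π`
  obtain ⟨π₀, μ, j, M, hsr⟩ :=
    π.exists_isShiftRealisation_of_sSup_irreducible
      AutomorphicRepsGL.stable_cuspidal_eq_sSup_irreducible_holds
  -- (2) transfer of the `K(𝔫)`-fixed vector and of the infinity type
  obtain ⟨φ₀, hφ₀W, hφ₀0, hφ₀fix⟩ := hsr.exists_fixed_ne_zero h𝔫 hφW hφW' hfix
  have hφ₀W' : φ₀ ∉ π₀.1.W' := fun hmem => hφ₀0 (by
    rw [hsr.bot] at hmem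
    exact (Submodule.mem_bot ℂ).1 hmem)
  obtain ⟨T, hTT, hTa⟩ := hT
  -- (3) the exact scalars `c₀ v i` of `T_{v,i}(ϖ_v)` on the `K(𝔫)`-invariants of `C` (Flath; `W₀' = ⊥`)
  have hS₀ := π₀.1.Flath1979_heckeOperator_ofLocal_sub_smul_mem_holds
  choose c₀ hc₀ using fun (v : HeightOneSpectrum (𝓞 K)) (i : ℕ) =>
    hS₀ v (glDiagonal n (v.adicCompletion K) fun k =>
      if (k : ℕ) < i then BigHeckeGLn.uniformizerAt v else 1)
  have hc₀exact : ∀ v : HeightOneSpectrum (𝓞 K), ¬ v.asIdeal ∣ 𝔫 → ∀ i ≤ n, ∀ ψ ∈ π₀.1.W,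
      (∀ u ∈ principalCongruenceLevel n K 𝔫, rightTranslation (AdelicGroupData.gl n K) u ψ = ψ) →
      heckeOperator (rightTranslation (AdelicGroupData.gl n K)) (principalCongruenceLevel n K 𝔫)
          (heckeDiagAt n K v (uniformizerAt v) i) ψ = c₀ v i • ψ := by
    intro v hv i _ ψ hψW hψfix
    have hmem := hc₀ v i h𝔫 hv ψ hψW hψfix
    rw [← heckeDiagAt_eq_ofLocal_glDiagonal, hsr.bot, Submodule.mem_bot] at hmem
    exact sub_eq_zero.1 hmem
  -- (4) the clean statement for `π₀`
  obtain ⟨q, ω, hω, hne, heig⟩ := hC n K hcpt 𝔫 lam hn h𝔫 hlam π₀ hsr.bot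
    ⟨μ, fun c hc => hsr.lieDeriv_one_eq_smul hc⟩ ⟨T, hsr.hasInfinityType hTT, hTa⟩
    ⟨φ₀, hφ₀W, hφ₀0, hφ₀fix⟩ c₀ hc₀exact
  refine ⟨q, ω, hω, hne, fun v hv i hi cL y hy vec => ?_⟩
  -- (5) `c v i = c₀ v i` at `v ∤ 𝔫`: both are the Satake–Tamagawa value of THE Satake parameter of `π`
  have hS := π.1.Flath1979_heckeOperator_ofLocal_sub_smul_mem_holds
  obtain ⟨α₀, hα₀⟩ := AutomorphicRepData.hasSatakeParamAt_of_fixed hS₀ h𝔫 hv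
    (BigHeckeGLn.valued_uniformizerAt v) hφ₀W hφ₀W' hφ₀fix
  have hαπ : π.1.HasSatakeParamAt v α₀ := hsr.hasSatakeParamAt hα₀
  have hcv : c v i = ((Real.sqrt (v.residueCard : ℝ) : ℝ) : ℂ) ^ (i * (n - i)) * α₀.esymm i :=
    hαπ.eq_esymm_of_sub_smul_mem hS h𝔫 hv (BigHeckeGLn.valued_uniformizerAt v) hφW hφW' hfix hi
      (hc v hv i hi)
  have hc₀v : c₀ v i = ((Real.sqrt (v.residueCard : ℝ) : ℝ) : ℂ) ^ (i * (n - i)) * α₀.esymm i := by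
    refine hα₀.eq_esymm_of_sub_smul_mem hS₀ h𝔫 hv (BigHeckeGLn.valued_uniformizerAt v) hφ₀W hφ₀W'
      hφ₀fix hi ?_
    rw [hc₀exact v hv i hi φ₀ hφ₀W hφ₀fix, sub_self]
    exact zero_mem _
  rw [heig v hv i hi cL y hy vec, hc₀v, ← hcv]

end Summit.Langlands.Langlands.Theorems.HeckeEigenvalueField.Res

end
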